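import Literature.InformationTheory.Entropy.VonNeumannEntropyInequalities
import Literature.InformationTheory.Entropy.RelativeEntropyMonotonicityDensity
import Literature.MathematicalPhysics.QuantumLattice.FinDimSpectrum
import Literature.LinearAlgebra.Matrix.PosSemidefTrace
import Mathlib.Analysis.SpecialFunctions.ContinuousFunctionalCalculus.ExpLog.Order
import HarnessLib

/-!
# The tangent (Lindblad) dual certificate for the conditional free energy:
# `S(ρ_{AB}) − S(ρ_B) − tr(ρ H) ≤ c` whenever `Tr_A e^{−H + 𝟙 ⊗ L_B} ≤ e^c · e^{L_B}`

Topic `MathematicalPhysics/QuantumLattice`, namespace `Literature.MathematicalPhysics.QuantumLattice`.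

For a bipartite system `ℋ_A ⊗ ℋ_B` (complex matrices indexed by `m × n`, `Tr_A = traceLeft`), a
Hermitian "energy" `H`, and a density matrix `ρ`, the CONDITIONAL FREE ENERGY functional
`ρ ↦ S(ρ) − S(Tr_A ρ) − Re tr(ρ H)` (conditional entropy minus energy; concave in `ρ` by Lieb–Ruskai)
admits the following LINEAR upper certificates: for every Hermitian `L_B` on `ℋ_B` ("dual variable")
and every real `c` with

  `Tr_A exp(−H + 𝟙_A ⊗ L_B) ≤ e^c · exp(L_B)`   (Löwner order),

one has, for EVERY density matrix `ρ`,

  `S(ρ) − S(Tr_A ρ) − Re tr(ρ H) ≤ c`              (`vonNeumannEntropy_sub_traceLeft_sub_le_of_certificate`).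

PROOF. Lindblad's tangent inequality (the monotonicity of the relative entropy under `Tr_A`,
tree THEOREM `relEntropy_partialTrace_le_holds`, in the form
`entropy_increment_le_tangent_of_relEntropy_partialTrace_le`): for every faithful state `τ`,
`S(ρ) − S(Tr_A ρ) ≤ −Re tr(ρ log τ) + Re tr(Tr_A ρ · log Tr_A τ)`. With `τ = e^X / tr e^X`,
`X = −H + 𝟙 ⊗ L_B`: `log τ = X − log Z`, `Tr_A τ = P / Z` with `P = Tr_A e^X`, so the right side is
`Re tr(ρ H) − Re tr(ρ_B L_B) + Re tr(ρ_B log P)`; the certificate and the OPERATOR MONOTONICITY OF THE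
LOGARITHM (Löwner–Heinz; Mathlib `CFC.log_le_log`) give `log P ≤ c + L_B`, whence
`Re tr(ρ_B log P) ≤ c + Re tr(ρ_B L_B)` and the `L_B` terms cancel. [cite: Lindblad1975, Lemma 2 p.149]
[cite: PoulinHastings2011, eqs. (4)–(8)] The optimum over `(L_B, c)` is the Legendre dual of the
concave conditional-entropy functional; this is the single-shield case of the Markov-entropy-decomposition
lower bound on the free energy of Poulin–Hastings (the free energy is bounded BELOW, i.e. the pressure
ABOVE, by conditional entropies of a site given a finite shield). The hypothesis on `X` is used only
through the linear identity `tr(ρ X) = tr(Tr_A ρ · L_B) − tr(ρ H)` (`hXρ`), which is how the lattice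
consumers (fermionic windows, `FermionEntropyChainRule.lean`) instantiate it after a Jordan–Wigner
reindexing. Everything is PROVED; no definition, no named fact.

## References

* G. Lindblad, *Completely positive maps and entropy inequalities*, Commun. Math. Phys. 40 (1975)
  147–151, Lemma 2. [Lindblad1975]
* D. Poulin, M. B. Hastings, *Markov entropy decomposition: a variational dual for quantum belief
  propagation*, Phys. Rev. Lett. 106 (2011) 080403, eqs. (4)–(8). [PoulinHastings2011]
* D. Petz, *Quantum Information Theory and Quantum Statistics* (Springer 2008), §11.6 (operator
  monotonicity of `log`). [Petz2008]

## Mathlib / tree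

`CFC.log_le_log`, `CFC.log_smul'`, `CFC.log_exp`, `CFC.real_exp_eq_normedSpace_exp` (Mathlib, on
`Matrix _ _ ℂ` with `open scoped Matrix.Norms.L2Operator MatrixOrder`); tree: `relEntropy_partialTrace_le_holds`,
`entropy_increment_le_tangent_of_relEntropy_partialTrace_le`, `posDef_traceLeft`, `trace_mul_one_kronecker`,
`traceLeft_submatrix_swap`, `posDef_gibbsWeight`, `re_trace_mul_nonneg_of_posSemidef`.
-/

noncomputable section

open Matrix
open scoped MatrixOrder ComplexOrder Kronecker

namespace Literature.MathematicalPhysics.QuantumLattice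

open Literature.Computability.QuantumComplexity (traceLeft traceRight IsDensity traceLeft_apply traceRight_apply
  trace_traceLeft)
open Literature.InformationTheory.Entropy (vonNeumannEntropy relEntropy_partialTrace_le_holds
  entropy_increment_le_tangent_of_relEntropy_partialTrace_le posDef_traceLeft trace_mul_one_kronecker
  traceLeft_submatrix_swap isHermitian_traceLeft)
open Literature.LinearAlgebra.Matrix (re_trace_mul_nonneg_of_posSemidef)

variable {m n : Type} [Fintype m] [Fintype n] [DecidableEq m] [DecidableEq n]

/-! ### Matrix-analysis lemmas -/

/-- `exp X` (functional calculus) of a Hermitian matrix is positive definite (`e^X ≥ 0` and invertible).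
[cite: BratteliRobinsonII1997, §5.3.1] -/
theorem posDef_cfc_exp {k : Type*} [Fintype k] [DecidableEq k] {X : Matrix k k ℂ} (hX : X.IsHermitian) :
    (cfc Real.exp X).PosDef := by
  open scoped Matrix.Norms.L2Operator in
  exact by
    rw [CFC.real_exp_eq_normedSpace_exp (ha := hX.isSelfAdjoint)]
    have h0 : (0 : Matrix k k ℂ) ≤ NormedSpace.exp X := hX.isSelfAdjoint.exp_nonneg
    exact (Matrix.nonneg_iff_posSemidef.mp h0).posDef_iff_isUnit.mpr (Matrix.isUnit_exp _)

/-- **Monotonicity of expectations in the Löwner order**: `A ≤ B`, `ρ ⪰ 0` ⟹ `Re tr(ρ A) ≤ Re tr(ρ B)`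
(positivity of the state `tr(ρ ·)` on the positive cone). [cite: Petz2008, §11.2] -/
theorem re_trace_mul_le_of_le {k : Type*} [Fintype k] [DecidableEq k] {ρ A B : Matrix k k ℂ}
    (hρ : ρ.PosSemidef) (hAB : A ≤ B) : (ρ * A).trace.re ≤ (ρ * B).trace.re := by
  have h := re_trace_mul_nonneg_of_posSemidef hρ (Matrix.le_iff.1 hAB)
  rw [Matrix.mul_sub, Matrix.trace_sub, Complex.sub_re] at h
  linarith

/-- **Operator monotonicity of the logarithm** (Löwner–Heinz) for positive definite complex matrices:
`0 < P ≤ Q ⟹ log P ≤ log Q` — Mathlib's `CFC.log_le_log` read on `Matrix k k ℂ` with the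
`L²`-operator-norm C⋆-structure. [cite: Petz2008, §11.6] -/
theorem cfc_log_le_cfc_log_of_le {k : Type*} [Fintype k] [DecidableEq k] {P Q : Matrix k k ℂ}
    (hP : P.PosDef) (hPQ : P ≤ Q) : cfc Real.log P ≤ cfc Real.log Q := by
  open scoped Matrix.Norms.L2Operator in
  exact by
    letI : CStarAlgebra (Matrix k k ℂ) := {}
    exact CFC.log_le_log (A := Matrix k k ℂ) hPQ hP.isStrictlyPositive

/-- `log (r • P) = log r · 𝟙 + log P` for `r > 0` and positive definite `P` (`ℂ`-scalar form).
[cite: Petz2008, §11.6] -/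
theorem cfc_log_smul_of_posDef {k : Type*} [Fintype k] [DecidableEq k] {P : Matrix k k ℂ}
    (hP : P.PosDef) {r : ℝ} (hr : 0 < r) :
    cfc Real.log ((r : ℂ) • P) = (Real.log r : ℂ) • (1 : Matrix k k ℂ) + cfc Real.log P := by
  open scoped Matrix.Norms.L2Operator in
  exact by
    letI : CStarAlgebra (Matrix k k ℂ) := {}
    have h := CFC.log_smul' (A := Matrix k k ℂ) P hr hP.isStrictlyPositive
    rw [CFC.log, CFC.log, Algebra.algebraMap_eq_smul_one] at h
    have e1 : ((r : ℂ) • P : Matrix k k ℂ) = (r • P : Matrix k k ℂ) := by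
      ext i j; simp [Matrix.smul_apply, Complex.real_smul]
    have e2 : ((Real.log r : ℂ) • (1 : Matrix k k ℂ)) = (Real.log r • (1 : Matrix k k ℂ)) := by
      ext i j; simp [Matrix.smul_apply, Complex.real_smul]
    rw [e1, e2]
    exact h

/-- `log (exp X) = X` for Hermitian `X` (functional calculus). [cite: Petz2008, §11.6] -/
theorem cfc_log_cfc_exp {k : Type*} [Fintype k] [DecidableEq k] {X : Matrix k k ℂ} (hX : X.IsHermitian) :
    cfc Real.log (cfc Real.exp X) = X := by
  open scoped Matrix.Norms.L2Operator in
  exact by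
    letI : CStarAlgebra (Matrix k k ℂ) := {}
    have h := CFC.log_exp (A := Matrix k k ℂ) X hX.isSelfAdjoint
    rwa [CFC.log, ← CFC.real_exp_eq_normedSpace_exp (ha := hX.isSelfAdjoint)] at h

/-- `log (e^c • exp L) = c · 𝟙 + L` for Hermitian `L`. [cite: Petz2008, §11.6] -/
theorem cfc_log_exp_smul_cfc_exp {k : Type*} [Fintype k] [DecidableEq k] {L : Matrix k k ℂ}
    (hL : L.IsHermitian) (c : ℝ) :
    cfc Real.log ((Real.exp c : ℂ) • cfc Real.exp L) = (c : ℂ) • (1 : Matrix k k ℂ) + L := by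
  rw [cfc_log_smul_of_posDef (posDef_cfc_exp hL) (Real.exp_pos c), Real.log_exp, cfc_log_cfc_exp hL]

omit [Fintype n] [DecidableEq m] [DecidableEq n] in
/-- `Tr_A` commutes with scalars. [folklore] -/
private theorem traceLeft_smul' (c : ℂ) (ρ : Matrix (m × n) (m × n) ℂ) :
    traceLeft (c • ρ) = c • traceLeft ρ := by
  ext b b'
  simp [traceLeft_apply, Finset.mul_sum]

/-- `Tr_B` of a positive definite matrix is positive definite (from the `Tr_A` case by swapping the
factors). [cite: NielsenChuang2010, §2.4.3] -/
theorem posDef_traceRight' [Nonempty n] {ρ : Matrix (m × n) (m × n) ℂ} (hρ : ρ.PosDef) :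
    (traceRight ρ).PosDef := by
  rw [← traceLeft_submatrix_swap]
  exact posDef_traceLeft (hρ.submatrix (Equiv.prodComm m n).symm.injective)

/-! ### The certificate theorem -/

/-- **Tangent (Lindblad) dual certificate for the conditional free energy.** Let `ρ` be a density
matrix on `ℋ_A ⊗ ℋ_B`, `X` Hermitian, `L_B` Hermitian on `ℋ_B`, `H` arbitrary, with the linear identity
`tr(ρ X) = tr(Tr_A ρ · L_B) − tr(ρ H)` (e.g. `X = −H + 𝟙 ⊗ L_B`). If the CERTIFICATE
`Tr_A e^X ≤ e^c · e^{L_B}` holds in the Löwner order (`hcert`, written as positive semidefiniteness of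
the difference), then `S(ρ) − S(Tr_A ρ) − Re tr(ρ H) ≤ c`. Proof: Lindblad's tangent inequality at
`τ = e^X / tr e^X`, then operator monotonicity of `log`. [cite: Lindblad1975, Lemma 2 p.149]
[cite: PoulinHastings2011, eqs. (4)–(8)] -/
theorem vonNeumannEntropy_sub_traceLeft_sub_le_of_certificate [Nonempty m] [Nonempty n]
    {ρ X H : Matrix (m × n) (m × n) ℂ} {LB : Matrix n n ℂ} {c : ℝ}
    (hρ : ρ.PosSemidef) (htr : ρ.trace = 1) (hX : X.IsHermitian) (hLB : LB.IsHermitian)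
    (hXρ : (ρ * X).trace = (traceLeft ρ * LB).trace - (ρ * H).trace)
    (hcert : ((Real.exp c : ℂ) • cfc Real.exp LB - traceLeft (cfc Real.exp X)).PosSemidef) :
    vonNeumannEntropy ρ - vonNeumannEntropy (traceLeft ρ) - (ρ * H).trace.re ≤ c := by
  -- the tangent state `τ = e^X / Z`
  set E : Matrix (m × n) (m × n) ℂ := cfc Real.exp X with hE
  have hEpd : E.PosDef := posDef_cfc_exp hX
  set Zr : ℝ := E.trace.re with hZr
  have hZ : E.trace = (Zr : ℂ) := by
    apply Complex.ext
    · simp [hZr]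
    · rw [Complex.ofReal_im]
      exact Literature.LinearAlgebra.Matrix.trace_im_of_posSemidef hEpd.posSemidef
  have hZr_pos : 0 < Zr := by
    have h := hEpd.trace_pos
    rw [hZ] at h
    exact_mod_cast h
  set τ : Matrix (m × n) (m × n) ℂ := ((Zr⁻¹ : ℝ) : ℂ) • E with hτ
  have hτpd : τ.PosDef := by
    rw [hτ]
    exact hEpd.smul (by exact_mod_cast inv_pos.2 hZr_pos)
  have hτtr : τ.trace = 1 := by
    rw [hτ, Matrix.trace_smul, hZ, smul_eq_mul, ← Complex.ofReal_mul, inv_mul_cancel₀ hZr_pos.ne',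
      Complex.ofReal_one]
  have hτd : IsDensity τ := ⟨hτpd.posSemidef, hτtr⟩
  have hρd : IsDensity ρ := ⟨hρ, htr⟩
  -- Lindblad's tangent inequality
  have htan := entropy_increment_le_tangent_of_relEntropy_partialTrace_le relEntropy_partialTrace_le_holds
    ρ τ hρd hτd hτpd (posDef_traceLeft hτpd) (posDef_traceRight' hτpd)
  -- `log τ = X − log Z`, `log Tr_A τ = log P − log Z`
  set P : Matrix n n ℂ := traceLeft E with hP
  have hPpd : P.PosDef := posDef_traceLeft hEpd
  have hlogτ : cfc Real.log τ = (Real.log Zr⁻¹ : ℂ) • (1 : Matrix (m × n) (m × n) ℂ) + X := by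
    rw [hτ, cfc_log_smul_of_posDef hEpd (inv_pos.2 hZr_pos), hE, cfc_log_cfc_exp hX]
  have hlogτB : cfc Real.log (traceLeft τ) = (Real.log Zr⁻¹ : ℂ) • (1 : Matrix n n ℂ) + cfc Real.log P := by
    rw [hτ, traceLeft_smul', cfc_log_smul_of_posDef hPpd (inv_pos.2 hZr_pos)]
  -- the certificate: `log P ≤ c + L_B`
  have hlogP : cfc Real.log P ≤ (c : ℂ) • (1 : Matrix n n ℂ) + LB := by
    rw [← cfc_log_exp_smul_cfc_exp hLB c]
    exact cfc_log_le_cfc_log_of_le hPpd (Matrix.le_iff.2 hcert)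
  have hρB : (traceLeft ρ).PosSemidef :=
    Literature.MathematicalPhysics.QuantumLattice.posSemidef_traceLeft hρ
  have htrB : (traceLeft ρ).trace = 1 := by rw [trace_traceLeft, htr]
  have hmono := re_trace_mul_le_of_le hρB hlogP
  -- bookkeeping of the traces
  have e1 : (ρ * cfc Real.log τ).trace.re = Real.log Zr⁻¹ + (ρ * X).trace.re := by
    rw [hlogτ, Matrix.mul_add, Matrix.trace_add, Matrix.mul_smul, Matrix.mul_one, Matrix.trace_smul, htr,
      Complex.add_re, smul_eq_mul, mul_one, Complex.ofReal_re]
  have e2 : (traceLeft ρ * cfc Real.log (traceLeft τ)).trace.re =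
      Real.log Zr⁻¹ + (traceLeft ρ * cfc Real.log P).trace.re := by
    rw [hlogτB, Matrix.mul_add, Matrix.trace_add, Matrix.mul_smul, Matrix.mul_one, Matrix.trace_smul, htrB,
      Complex.add_re, smul_eq_mul, mul_one, Complex.ofReal_re]
  have e3 : (traceLeft ρ * ((c : ℂ) • (1 : Matrix n n ℂ) + LB)).trace.re = c + (traceLeft ρ * LB).trace.re := by
    rw [Matrix.mul_add, Matrix.trace_add, Matrix.mul_smul, Matrix.mul_one, Matrix.trace_smul, htrB,
      Complex.add_re, smul_eq_mul, mul_one, Complex.ofReal_re]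
  have e4 : (ρ * X).trace.re = (traceLeft ρ * LB).trace.re - (ρ * H).trace.re := by
    rw [hXρ, Complex.sub_re]
  rw [e1, e2] at htan
  rw [e3] at hmono
  linarith

end Literature.MathematicalPhysics.QuantumLattice

end
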